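import Summits.CriticalPhenomena.PercolationContinuityZ3.Theorems.PercNearOneGluingNoHeavyLowerTailAntitheticFan6NotOplusShift
import HarnessLib

/-!
# `NoHeavyLowerTail` (stmt-CriticalPhenomena-4575) — antithetic cluster pairs: **CONJECTURE T2 IS FALSE — TOP_shift fails at a vertex that NO
# cut vertex separates from the source** (`K_{2,6}` between `s` and `h` plus the path `s – a – b – c – P – h`: 12 vertices, 17 pairs;
# prim-hp-2 gen 72, HOME/MEMO-gen72.md §1, HOME/THEOREM-T2.md)

Support file (`--supports stmt-CriticalPhenomena-4575`, hull-port prover `prim-hp-2`, gen 72).  No definitions, no named facts, no sorries;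
COMPUTATIONAL (`native_decide` evaluates one integer sum over the `2^17` sub-colourings; clusters by the BFS ball `reachN` of
…AntitheticReachN, computed by an EARLY-EXIT iteration with the two clusters of a colouring SHARED between the event and the summand —
`K26Path.fast_eq_reachN` + a `let`-form of the summand: 114 s instead of 560 s on the farm; reusable for every certificate file).  A negative result: it kills no item and no theorem; it closes the programme's search for a connectivity hypothesis
under which the TOP event alone would carry the |R| = 1 vertex antithetic inequality (`TopVertex.vertex_sum_nonneg_of_top`).

HISTORY.  TOP(E; P) is the sum of `(F⁺(X) − F⁻(Y))(G⁺(X) − G⁻(Y))` over the colourings with `P ∈ X ∖ Y` (`X, Y` the red / blue cluster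
of the source).  "CONJECTURE T" (TOP_shift ≥ 0 always; exact for every connected rooted graph on ≤ 6 vertices, all 21 090 classes on 7
vertices) died at the PENDANT PROBE (…AntitheticTopPendant, gen 69: a pendant vertex hung at the hub of the 6-fan, a cut vertex between
`s` and `P`); gen 69 restated it as CONJECTURE T2: TOP_shift(K; P) ≥ 0 whenever no cut vertex separates `s` from `P`.  THE LONG-PATH PROBE
kills T2: hang `P` at the pole `h` of a non-⊕ two-terminal gadget (`K_{2,6}` between `s` and `h`; ⊕_shift(K_{2,k}; pole) < 0 for
`k ≥ 5`, HOME/THEOREM-Fans.md) AND join `P` to `s` by a path `s – a – b – c – P`: the pair `(s, P)` is now 2-connected (`s – a – b – c – P`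
and `s – leaf – h – P` are internally disjoint), but the path rarely carries the blue cluster, so on most of the TOP event `P` is reached
exactly as the pendant vertex was, and the ⊕ failure of the pole is inherited (gen-72 fan calculus: TOP = 4A − 5|B| for the degree-2
probe, HOME/THEOREM-T2.md; exact value here −388, brute force over all `2^17` colourings and the fan-calculus product formula agree).
* `Antithetic.K26Path.exists_negative_top_pair` — for `E` = the 17 pairs below on `Fin 12` (source `0`, pole `h = 1`, path `0–2–3–4–5`,
  target `P = 5 ∼ 1`, leaves `6,…,11` joined to `0` and `1`) and `F⁺ = F⁻ = 𝟙[{6,7,8} ⊆ ·]`, `G⁺ = G⁻ = 𝟙[{9,10,11} ⊆ ·]`: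
  `Σ_{θ ⊆ E : 5 ∈ X θ, 5 ∉ Y θ} (F⁺(X θ) − F⁻(Y θ))·(G⁺(X θ) − G⁻(Y θ)) = −388 < 0`.
* `Antithetic.K26Path.iterate_stop_fst_eq`, `reachN_eq_iterate`, `fast_eq_reachN` — generic: the early-exit BFS
  `(S, done) ↦ (done ? (S, done) : reachStep E S = S ? (S, true) : (reachStep E S, false))` iterated `k` times from `({s}, false)` returns
  `reachN E s k` (so certificate sums may be rewritten into a cheap shared-`let` form before `native_decide`).
* `Antithetic.K26Path.not_top_shift_powerset` — hence TOP_shift(E; 5) fails although no cut vertex separates `0` from `5` (CONJECTURE T2 of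
  HOME/MEMO-gen69.md §3 is false; smallest instance found: 12 vertices / 17 pairs; the |R| = 1 vertex antithetic inequality at `5` itself
  holds there, value `+` in the same normalisation — the sum on `{5 ∉ Y}` again compensates).
[cite: VandenbergHaggstromKahn2005, §1 p. 3 (open cluster `C_s`)]
-/

namespace Summit.CriticalPhenomena.PercolationContinuityZ3.Theorems

open Literature.Probability.Percolation

namespace Antithetic

namespace K26Path

section FastReach

variable {W : Type*} [Fintype W] [DecidableEq W]

/-- **Early-exit breadth-first search** (keeps `native_decide` certificates fast): iterating the step
`(S, done) ↦ if done then (S, done) else if reachStep E S = S then (S, true) else (reachStep E S, false)`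
`k` times from `(S, d)` yields the same set as `k` plain BFS steps, provided `d = true` only at a fixpoint. [this work] -/
theorem iterate_stop_fst_eq (E : Finset (Sym2 W)) :
    ∀ (k : ℕ) (S : Finset W) (d : Bool), (d = true → reachStep E S = S) →
      ((fun p : Finset W × Bool =>
          if p.2 = true then p else if reachStep E p.1 = p.1 then (p.1, true) else (reachStep E p.1, false))^[k] (S, d)).1 =
        (reachStep E)^[k] S := by
  intro k
  induction k with
  | zero => intro S d _; rfl
  | succ k ih =>
      intro S d hd
      rw [Function.iterate_succ_apply, Function.iterate_succ_apply]
      cases d with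
      | true =>
          have hfix : reachStep E S = S := hd rfl
          simp only [ite_true]
          rw [ih S true (fun _ => hfix), hfix]
      | false =>
          by_cases hfix : reachStep E S = S
          · simp only [Bool.false_eq_true, ite_false, hfix, ite_true]
            exact ih S true (fun _ => hfix)
          · simp only [Bool.false_eq_true, ite_false, hfix]
            exact ih (reachStep E S) false (fun h => absurd h Bool.false_ne_true)

/-- `reachN` is the `k`-fold iterate of `reachStep` from `{s}`. [this work] -/
theorem reachN_eq_iterate (E : Finset (Sym2 W)) (s : W) : ∀ k : ℕ, reachN E s k = (reachStep E)^[k] {s}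
  | 0 => rfl
  | k + 1 => by
      rw [Function.iterate_succ_apply', ← reachN_eq_iterate E s k]
      rfl

/-- **The early-exit BFS computes the BFS ball `reachN`.** [this work] -/
theorem fast_eq_reachN (E : Finset (Sym2 W)) (s : W) (k : ℕ) :
    ((fun p : Finset W × Bool =>
        if p.2 = true then p else if reachStep E p.1 = p.1 then (p.1, true) else (reachStep E p.1, false))^[k] ({s}, false)).1 =
      reachN E s k := by
  rw [iterate_stop_fst_eq E k {s} false (fun h => absurd h Bool.false_ne_true), reachN_eq_iterate]

end FastReach


set_option maxRecDepth 8192 in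
/-- **An explicit monotone pair with NEGATIVE TOP_shift sum at a vertex 2-connected to the source: `K_{2,6}(s, h)` + path `s–a–b–c–P–h`,
target `P`.**  With `F⁺ = F⁻ = 𝟙[{6,7,8} ⊆ ·]`, `G⁺ = G⁻ = 𝟙[{9,10,11} ⊆ ·]`:
`Σ_{θ ⊆ E : 5 ∈ X θ, 5 ∉ Y θ} (F⁺(X θ) − F⁻(Y θ))·(G⁺(X θ) − G⁻(Y θ)) < 0` (value −388), `E` = {02, 23, 34, 45, 15, 06,…,0 11, 16,…,1 11}
(source `0`). [this work, checked computation] -/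
theorem exists_negative_top_pair : ∃ Fp Fm Gp Gm : Set (Fin 12) → ℝ,
    Monotone Fp ∧ Monotone Fm ∧ (∀ S, Fm S ≤ Fp S) ∧ Monotone Gp ∧ Monotone Gm ∧ (∀ S, Gm S ≤ Gp S) ∧
    ∑ θ ∈ (Finset.powerset ({s(0, 2), s(2, 3), s(3, 4), s(4, 5), s(1, 5), s(0, 6), s(0, 7), s(0, 8), s(0, 9), s(0, 10), s(0, 11), s(1, 6), s(1, 7), s(1, 8), s(1, 9), s(1, 10), s(1, 11)} : Finset (Sym2 (Fin 12)))).filter (fun (θ : Finset (Sym2 (Fin 12))) =>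
        (SimpleGraph.fromEdgeSet (↑θ : Set (Sym2 (Fin 12)))).Reachable 0 5
          ∧ ¬ (SimpleGraph.fromEdgeSet (↑(({s(0, 2), s(2, 3), s(3, 4), s(4, 5), s(1, 5), s(0, 6), s(0, 7), s(0, 8), s(0, 9), s(0, 10), s(0, 11), s(1, 6), s(1, 7), s(1, 8), s(1, 9), s(1, 10), s(1, 11)} : Finset (Sym2 (Fin 12))) \ θ) : Set (Sym2 (Fin 12)))).Reachable 0 5),
      (Fp (openCluster (↑θ : Set (Sym2 (Fin 12))) 0) - Fm (openCluster (↑(({s(0, 2), s(2, 3), s(3, 4), s(4, 5), s(1, 5), s(0, 6), s(0, 7), s(0, 8), s(0, 9), s(0, 10), s(0, 11), s(1, 6), s(1, 7), s(1, 8), s(1, 9), s(1, 10), s(1, 11)} : Finset (Sym2 (Fin 12))) \ θ) : Set (Sym2 (Fin 12))) 0)) *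
        (Gp (openCluster (↑θ : Set (Sym2 (Fin 12))) 0) - Gm (openCluster (↑(({s(0, 2), s(2, 3), s(3, 4), s(4, 5), s(1, 5), s(0, 6), s(0, 7), s(0, 8), s(0, 9), s(0, 10), s(0, 11), s(1, 6), s(1, 7), s(1, 8), s(1, 9), s(1, 10), s(1, 11)} : Finset (Sym2 (Fin 12))) \ θ) : Set (Sym2 (Fin 12))) 0)) < 0 := by
  -- monotonicity of an indicator `[g ⊆ A]` through `Set.toFinset`
  have hmono : ∀ (g : Finset (Fin 12)), Monotone (fun A : Set (Fin 12) =>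
      (((if g ⊆ @Set.toFinset _ A (Fintype.ofFinite A) then (1 : ℤ) else 0 : ℤ) : ℝ))) := by
    intro g A A' hA
    have hA' : @Set.toFinset _ A (Fintype.ofFinite A) ⊆ @Set.toFinset _ A' (Fintype.ofFinite A') :=
      (@Set.toFinset_subset_toFinset _ A A' (Fintype.ofFinite A) (Fintype.ofFinite A')).2 hA
    dsimp only
    split_ifs with h1 h2
    · exact le_rfl
    · exact absurd (h1.trans hA') h2
    · exact_mod_cast zero_le_one
    · exact le_rfl
  -- cluster computations by the BFS ball `reachN`
  have hX : ∀ θ : Finset (Sym2 (Fin 12)), openCluster (↑θ : Set (Sym2 (Fin 12))) 0 = ↑(reachN θ (0 : Fin 12) 11) := fun θ =>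
    openCluster_eq_coe_reachN θ (0 : Fin 12) (by simp)
  have hD : (Finset.powerset ({s(0, 2), s(2, 3), s(3, 4), s(4, 5), s(1, 5), s(0, 6), s(0, 7), s(0, 8), s(0, 9), s(0, 10), s(0, 11), s(1, 6), s(1, 7), s(1, 8), s(1, 9), s(1, 10), s(1, 11)} : Finset (Sym2 (Fin 12)))).filter (fun (θ : Finset (Sym2 (Fin 12))) =>
        (SimpleGraph.fromEdgeSet (↑θ : Set (Sym2 (Fin 12)))).Reachable 0 5
          ∧ ¬ (SimpleGraph.fromEdgeSet (↑(({s(0, 2), s(2, 3), s(3, 4), s(4, 5), s(1, 5), s(0, 6), s(0, 7), s(0, 8), s(0, 9), s(0, 10), s(0, 11), s(1, 6), s(1, 7), s(1, 8), s(1, 9), s(1, 10), s(1, 11)} : Finset (Sym2 (Fin 12))) \ θ) : Set (Sym2 (Fin 12)))).Reachable 0 5) =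
      (Finset.powerset ({s(0, 2), s(2, 3), s(3, 4), s(4, 5), s(1, 5), s(0, 6), s(0, 7), s(0, 8), s(0, 9), s(0, 10), s(0, 11), s(1, 6), s(1, 7), s(1, 8), s(1, 9), s(1, 10), s(1, 11)} : Finset (Sym2 (Fin 12)))).filter (fun (θ : Finset (Sym2 (Fin 12))) => (5 : Fin 12) ∈ reachN θ (0 : Fin 12) 11 ∧
          ¬ ((5 : Fin 12) ∈ reachN (({s(0, 2), s(2, 3), s(3, 4), s(4, 5), s(1, 5), s(0, 6), s(0, 7), s(0, 8), s(0, 9), s(0, 10), s(0, 11), s(1, 6), s(1, 7), s(1, 8), s(1, 9), s(1, 10), s(1, 11)} : Finset (Sym2 (Fin 12))) \ θ) (0 : Fin 12) 11)) := by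
    refine Finset.filter_congr fun θ _ => ?_
    rw [mem_reachN_iff θ (0 : Fin 12) (5 : Fin 12) (by simp), mem_reachN_iff _ (0 : Fin 12) (5 : Fin 12) (by simp)]
  refine ⟨fun A => (((if ({6, 7, 8} : Finset (Fin 12)) ⊆ @Set.toFinset _ A (Fintype.ofFinite A) then (1 : ℤ) else 0 : ℤ) : ℝ)), fun A => (((if ({6, 7, 8} : Finset (Fin 12)) ⊆ @Set.toFinset _ A (Fintype.ofFinite A) then (1 : ℤ) else 0 : ℤ) : ℝ)),
    fun A => (((if ({9, 10, 11} : Finset (Fin 12)) ⊆ @Set.toFinset _ A (Fintype.ofFinite A) then (1 : ℤ) else 0 : ℤ) : ℝ)), fun A => (((if ({9, 10, 11} : Finset (Fin 12)) ⊆ @Set.toFinset _ A (Fintype.ofFinite A) then (1 : ℤ) else 0 : ℤ) : ℝ)),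
    hmono _, hmono _, fun S => le_rfl, hmono _, hmono _, fun S => le_rfl, ?_⟩
  rw [hD]
  simp only [hX, Finset.toFinset_coe]
  refine NegTools.cast_sum_neg _ _ _ _ _ ?_
  -- evaluate: share the two cluster computations of each colouring (`let`) and use the early-exit BFS (`fast_eq_reachN`)
  rw [Finset.sum_filter]
  calc _ = ∑ a ∈ Finset.powerset ({s(0, 2), s(2, 3), s(3, 4), s(4, 5), s(1, 5), s(0, 6), s(0, 7), s(0, 8), s(0, 9), s(0, 10), s(0, 11), s(1, 6), s(1, 7), s(1, 8), s(1, 9), s(1, 10), s(1, 11)} : Finset (Sym2 (Fin 12))),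
        (let X : Finset (Fin 12) := ((fun p : Finset (Fin 12) × Bool => if p.2 = true then p else if reachStep a p.1 = p.1 then (p.1, true) else (reachStep a p.1, false))^[11] (({(0 : Fin 12)} : Finset (Fin 12)), false)).1
        let Y : Finset (Fin 12) := ((fun p : Finset (Fin 12) × Bool => if p.2 = true then p else if reachStep (({s(0, 2), s(2, 3), s(3, 4), s(4, 5), s(1, 5), s(0, 6), s(0, 7), s(0, 8), s(0, 9), s(0, 10), s(0, 11), s(1, 6), s(1, 7), s(1, 8), s(1, 9), s(1, 10), s(1, 11)} : Finset (Sym2 (Fin 12))) \ a) p.1 = p.1 then (p.1, true) else (reachStep (({s(0, 2), s(2, 3), s(3, 4), s(4, 5), s(1, 5), s(0, 6), s(0, 7), s(0, 8), s(0, 9), s(0, 10), s(0, 11), s(1, 6), s(1, 7), s(1, 8), s(1, 9), s(1, 10), s(1, 11)} : Finset (Sym2 (Fin 12))) \ a) p.1, false))^[11] (({(0 : Fin 12)} : Finset (Fin 12)), false)).1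
        if (5 : Fin 12) ∈ X ∧ (5 : Fin 12) ∉ Y then
          ((if ({6, 7, 8} : Finset (Fin 12)) ⊆ X then (1 : ℤ) else 0) - (if ({6, 7, 8} : Finset (Fin 12)) ⊆ Y then (1 : ℤ) else 0)) *
            ((if ({9, 10, 11} : Finset (Fin 12)) ⊆ X then (1 : ℤ) else 0) - (if ({9, 10, 11} : Finset (Fin 12)) ⊆ Y then (1 : ℤ) else 0))
        else 0) :=
          Finset.sum_congr rfl (fun a _ => by simp only [fast_eq_reachN])
    _ < 0 := by native_decide

/-- **TOP_shift fails at a vertex that no cut vertex separates from the source** — CONJECTURE T2 (HOME/MEMO-gen69.md §3: TOP_shift(K; P) ≥ 0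
whenever no cut vertex separates `s` from `P`) is false: here `P = 5` lies on the two internally disjoint paths `0–2–3–4–5` and `0–6–1–5`.
[this work] -/
theorem not_top_shift_powerset : ¬ ∀ Fp Fm Gp Gm : Set (Fin 12) → ℝ, Monotone Fp → Monotone Fm → (∀ S, Fm S ≤ Fp S) →
    Monotone Gp → Monotone Gm → (∀ S, Gm S ≤ Gp S) →
    0 ≤ ∑ θ ∈ (Finset.powerset ({s(0, 2), s(2, 3), s(3, 4), s(4, 5), s(1, 5), s(0, 6), s(0, 7), s(0, 8), s(0, 9), s(0, 10), s(0, 11), s(1, 6), s(1, 7), s(1, 8), s(1, 9), s(1, 10), s(1, 11)} : Finset (Sym2 (Fin 12)))).filter (fun (θ : Finset (Sym2 (Fin 12))) =>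
        (SimpleGraph.fromEdgeSet (↑θ : Set (Sym2 (Fin 12)))).Reachable 0 5
          ∧ ¬ (SimpleGraph.fromEdgeSet (↑(({s(0, 2), s(2, 3), s(3, 4), s(4, 5), s(1, 5), s(0, 6), s(0, 7), s(0, 8), s(0, 9), s(0, 10), s(0, 11), s(1, 6), s(1, 7), s(1, 8), s(1, 9), s(1, 10), s(1, 11)} : Finset (Sym2 (Fin 12))) \ θ) : Set (Sym2 (Fin 12)))).Reachable 0 5),
      (Fp (openCluster (↑θ : Set (Sym2 (Fin 12))) 0) - Fm (openCluster (↑(({s(0, 2), s(2, 3), s(3, 4), s(4, 5), s(1, 5), s(0, 6), s(0, 7), s(0, 8), s(0, 9), s(0, 10), s(0, 11), s(1, 6), s(1, 7), s(1, 8), s(1, 9), s(1, 10), s(1, 11)} : Finset (Sym2 (Fin 12))) \ θ) : Set (Sym2 (Fin 12))) 0)) *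
        (Gp (openCluster (↑θ : Set (Sym2 (Fin 12))) 0) - Gm (openCluster (↑(({s(0, 2), s(2, 3), s(3, 4), s(4, 5), s(1, 5), s(0, 6), s(0, 7), s(0, 8), s(0, 9), s(0, 10), s(0, 11), s(1, 6), s(1, 7), s(1, 8), s(1, 9), s(1, 10), s(1, 11)} : Finset (Sym2 (Fin 12))) \ θ) : Set (Sym2 (Fin 12))) 0)) := by
  intro h
  obtain ⟨Fp, Fm, Gp, Gm, hFp, hFm, hF, hGp, hGm, hG, hlt⟩ := exists_negative_top_pair
  exact absurd (h Fp Fm Gp Gm hFp hFm hF hGp hGm hG) (not_le.2 hlt)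

end K26Path

end Antithetic

end Summit.CriticalPhenomena.PercolationContinuityZ3.Theorems
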